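import Summits.BirchSwinnertonDyer.BirchSwinnertonDyer.Theorems.TangentConeSelmerRankSmallImageCMKernel
import Literature.NumberTheory.EllipticCurves.CMModPImageNotSurjectiveProofs

/-!
# BirchSwinnertonDyer / TangentCone — the crux `SelmerRankSmallImage` (stmt-BirchSwinnertonDyer-14418)
# is EXACTLY rank BSD for CM curves in analytic rank `≥ 2`, modulo the route's other items

`TangentConeSelmerRankSmallImageCMKernel` proved, inside route TangentCone (items `EdgeDecay`,
`EdgeCap`, `SelmerRankLB`, `SelmerRankShaPFinite`, `RankLeOne`), the implications
`CMRank≥2 ⟹ SelmerRankSmallImage` and — granted a "small-image prime supply" for CM curves —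
`SelmerRankSmallImage ⟹ CMRank` (`cmRank_of_selmerRankSmallImage`), where

  `CMRank≥2 := ∀ W elliptic, globally minimal, W.HasCM → 2 ≤ r_an(W) → rank W = r_an(W)`

is the rank part of the Birch and Swinnerton-Dyer conjecture for CM curves in analytic rank `≥ 2`
(OPEN).  The supply is now a THEOREM of the tree
(`Literature.NumberTheory.EllipticCurves.exists_goodOrdinary_not_hasSurjectiveModNGaloisRep_of_hasCM`:
Serre 1972 §4.5, from Lang's main theorem of complex multiplication on torsion,
`cmTorsion_cartanImage_holds`, and the infinitude of good ordinary primes), so this file records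
the clean characterisation, sorry-free and with no hypothesis beyond the route's items:

* `cmRank_of_selmerRankSmallImage_of_shaPFinite` — `SelmerRankShaPFinite → SelmerRankSmallImage
  →` rank BSD for every globally minimal CM curve (every analytic rank);
* `selmerRankSmallImage_iff_cmRank` — `EdgeDecay → EdgeCap → SelmerRankLB →
  SelmerRankShaPFinite → RankLeOne → (SelmerRankSmallImage ↔ CMRank≥2)`;
* `cmCore_iff_cmRank` — under `SelmerRankShaPFinite` alone, the line's registered CM stub
  `stub_cmCore` (the crux restricted to CM curves of analytic rank `≥ 2`, at the prime `p`) is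
  equivalent to `CMRank≥2` (`⟸`: Greenberg's identity; `⟹`: a good ordinary prime `≥ 5` exists,
  `exists_good_ordinary_prime_holds`);
* `selmerRankSmallImage_iff_cmCore` — hence, modulo the five route items,
  `SelmerRankSmallImage ↔ stub_cmCore`: the line `prime-switch` loses NOTHING — its one open stub
  is as strong as the crux itself inside the route.

Everything is CONDITIONAL on open route statements (implications between them); no definition,
no named fact, no `sorry`. Supports stmt-BirchSwinnertonDyer-14418 (it does not close it); it is
the formal content of the lead's `promote-stub` recommendation for `stub_cmCore`.
-/

-- D-0017: single-problem summit, so `Summit.BirchSwinnertonDyer.BirchSwinnertonDyer.…` repeats a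
-- namespace BY DESIGN.
set_option linter.dupNamespace false

namespace Summit.BirchSwinnertonDyer.BirchSwinnertonDyer.Theorems

open Summit.BirchSwinnertonDyer.BirchSwinnertonDyer.Theses
open Literature.NumberTheory.EllipticCurves

/-- **The crux gives back rank BSD for CM curves, unconditionally in the supply.**
`SelmerRankShaPFinite → SelmerRankSmallImage →` for every globally minimal CM curve `W/ℚ`,
`rank W(ℚ) = ord_{s=1} L(W,s)`: at a good ordinary prime `p ≥ 5` with non-surjective `ρ̄_{W,p}`
(`exists_goodOrdinary_not_hasSurjectiveModNGaloisRep_of_hasCM`, Serre 1972 §4.5 + Deuring) the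
crux reads `corank_p = r_an`, and `corank_p = rank` by `Ш[p^∞]`-finiteness. CONDITIONAL.
[cite: Serre1972, §4.5] -/
theorem cmRank_of_selmerRankSmallImage_of_shaPFinite
    (hSha : Summit.BirchSwinnertonDyer.BirchSwinnertonDyer.Theses.TangentCone.SelmerRankShaPFinite)
    (hSI : Summit.BirchSwinnertonDyer.BirchSwinnertonDyer.Theses.TangentCone.SelmerRankSmallImage)
    (W : WeierstrassCurve ℚ) [W.IsElliptic] [W.IsGloballyMinimal] (hW : W.HasCM) :
    W.mordellWeilRank = W.analyticRank :=
  cmRank_of_selmerRankSmallImage hSha hSI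
    (fun V _ _ hV => exists_goodOrdinary_not_hasSurjectiveModNGaloisRep_of_hasCM V hV) W hW

/-- **The characterisation.** Modulo route TangentCone's items `EdgeDecay`, `EdgeCap`,
`SelmerRankLB`, `SelmerRankShaPFinite`, `RankLeOne`, the crux `SelmerRankSmallImage` is
EQUIVALENT to rank BSD for CM curves in analytic rank `≥ 2`
(`tangentCone_selmerRankSmallImage_of_cmRank` and `cmRank_of_selmerRankSmallImage_of_shaPFinite`).
CONDITIONAL. [folklore] -/
theorem selmerRankSmallImage_iff_cmRank
    (hE : Summit.BirchSwinnertonDyer.BirchSwinnertonDyer.Theses.TangentCone.EdgeDecay)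
    (hC : Summit.BirchSwinnertonDyer.BirchSwinnertonDyer.Theses.TangentCone.EdgeCap)
    (hLB : Summit.BirchSwinnertonDyer.BirchSwinnertonDyer.Theses.TangentCone.SelmerRankLB)
    (hSha : Summit.BirchSwinnertonDyer.BirchSwinnertonDyer.Theses.TangentCone.SelmerRankShaPFinite)
    (hR1 : Summit.BirchSwinnertonDyer.BirchSwinnertonDyer.Theses.TangentCone.RankLeOne) :
    Summit.BirchSwinnertonDyer.BirchSwinnertonDyer.Theses.TangentCone.SelmerRankSmallImage ↔
      ∀ (W : WeierstrassCurve ℚ) [W.IsElliptic] [W.IsGloballyMinimal], W.HasCM →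
        2 ≤ W.analyticRank → W.mordellWeilRank = W.analyticRank :=
  ⟨fun hSI W _ _ hW _ => cmRank_of_selmerRankSmallImage_of_shaPFinite hSha hSI W hW,
    tangentCone_selmerRankSmallImage_of_cmRank hE hC hLB hSha hR1⟩

/-- **The line's CM stub versus rank BSD for CM curves.** Under `SelmerRankShaPFinite` alone, the
registered stub `stub_cmCore` of line `prime-switch` (the crux restricted to CM curves of
analytic rank `≥ 2`, read at the good ordinary prime `p` itself; spelled out verbatim) is
EQUIVALENT to rank BSD for CM curves in analytic rank `≥ 2`: `⟸` by Greenberg's identity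
(`selmerCorank_eq_mordellWeilRank_of_shaPFinite`), `⟹` at a good ordinary prime `≥ 5`, which
exists (`WeierstrassCurve.exists_good_ordinary_prime_holds`). CONDITIONAL. [cite: GreenbergLNM1716, §1] -/
theorem cmCore_iff_cmRank
    (hSha : Summit.BirchSwinnertonDyer.BirchSwinnertonDyer.Theses.TangentCone.SelmerRankShaPFinite) :
    (∀ (W : WeierstrassCurve ℚ) [W.IsElliptic] [W.IsGloballyMinimal] (p : ℕ) [Fact p.Prime],
      5 ≤ p → W.HasGoodReductionAtPrime p → ¬ (p : ℤ) ∣ W.frobeniusTrace p → W.HasCM →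
        2 ≤ W.analyticRank → W.selmerCorank p = W.analyticRank) ↔
    ∀ (W : WeierstrassCurve ℚ) [W.IsElliptic] [W.IsGloballyMinimal], W.HasCM →
      2 ≤ W.analyticRank → W.mordellWeilRank = W.analyticRank := by
  constructor
  · intro hCore W _ _ hW h2
    obtain ⟨p, hp, h5, hgood, hord⟩ := WeierstrassCurve.exists_good_ordinary_prime_holds W
    rw [← selmerCorank_eq_mordellWeilRank_of_shaPFinite hSha W p]
    exact hCore W p h5 hgood hord hW h2
  · intro hCM W _ _ p _ _ _ _ hW h2
    rw [selmerCorank_eq_mordellWeilRank_of_shaPFinite hSha W p]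
    exact hCM W hW h2

/-- **The line loses nothing.** Modulo route TangentCone's items `EdgeDecay`, `EdgeCap`,
`SelmerRankLB`, `SelmerRankShaPFinite`, `RankLeOne`, the crux `SelmerRankSmallImage` is
EQUIVALENT to its own restriction to CM curves of analytic rank `≥ 2` — the one open stub
`stub_cmCore` of line `prime-switch` (spelled out verbatim). CONDITIONAL. [folklore] -/
theorem selmerRankSmallImage_iff_cmCore :
    Summit.BirchSwinnertonDyer.BirchSwinnertonDyer.Theses.TangentCone.EdgeDecay →
    Summit.BirchSwinnertonDyer.BirchSwinnertonDyer.Theses.TangentCone.EdgeCap →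
    Summit.BirchSwinnertonDyer.BirchSwinnertonDyer.Theses.TangentCone.SelmerRankLB →
    Summit.BirchSwinnertonDyer.BirchSwinnertonDyer.Theses.TangentCone.SelmerRankShaPFinite →
    Summit.BirchSwinnertonDyer.BirchSwinnertonDyer.Theses.TangentCone.RankLeOne →
    (Summit.BirchSwinnertonDyer.BirchSwinnertonDyer.Theses.TangentCone.SelmerRankSmallImage ↔
      ∀ (W : WeierstrassCurve ℚ) [W.IsElliptic] [W.IsGloballyMinimal] (p : ℕ) [Fact p.Prime],
        5 ≤ p → W.HasGoodReductionAtPrime p → ¬ (p : ℤ) ∣ W.frobeniusTrace p → W.HasCM →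
          2 ≤ W.analyticRank → W.selmerCorank p = W.analyticRank) :=
  fun hE hC hLB hSha hR1 =>
    (selmerRankSmallImage_iff_cmRank hE hC hLB hSha hR1).trans (cmCore_iff_cmRank hSha).symm

/-! ### The re-glue: what route TangentCone needs in place of the crux -/

/-- **Re-glued closure of route TangentCone.** The route's certified deciding theorem
`TangentCone.closes` consumes the crux `SelmerRankSmallImage`; by
`tangentCone_selmerRankSmallImage_of_cmRank` it may consume instead rank BSD for CM curves in
analytic rank `≥ 2` (spelled out verbatim): `EdgeDecay → EdgeCap → SelmerRankLB →
SelmerRankShaPFinite → RankLeOne → CMRank≥2 → BirchSwinnertonDyer`. For NON-CM curves the crux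
is thus entirely absorbed by the route's other items (Serre prime + transfer); the planner may
replace item #6 by a CM-only statement. CONDITIONAL (every hypothesis is an open statement).
[folklore] -/
theorem tangentCone_bsd_of_items_of_cmRank
    (hE : Summit.BirchSwinnertonDyer.BirchSwinnertonDyer.Theses.TangentCone.EdgeDecay)
    (hC : Summit.BirchSwinnertonDyer.BirchSwinnertonDyer.Theses.TangentCone.EdgeCap)
    (hLB : Summit.BirchSwinnertonDyer.BirchSwinnertonDyer.Theses.TangentCone.SelmerRankLB)
    (hSha : Summit.BirchSwinnertonDyer.BirchSwinnertonDyer.Theses.TangentCone.SelmerRankShaPFinite)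
    (hR1 : Summit.BirchSwinnertonDyer.BirchSwinnertonDyer.Theses.TangentCone.RankLeOne)
    (hCM : ∀ (W : WeierstrassCurve ℚ) [W.IsElliptic] [W.IsGloballyMinimal], W.HasCM →
      2 ≤ W.analyticRank → W.mordellWeilRank = W.analyticRank) :
    _root_.BirchSwinnertonDyer :=
  Summit.BirchSwinnertonDyer.BirchSwinnertonDyer.Theses.TangentCone.closes hE hC hLB hSha
    (tangentCone_selmerRankSmallImage_of_cmRank hE hC hLB hSha hR1 hCM) hR1

/-- **The same with the CM input in `∃`-corank ("anchor") form**: `EdgeDecay → EdgeCap →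
SelmerRankLB → SelmerRankShaPFinite → RankLeOne → (∀ W CM glob-min, 2 ≤ r_an → ∃ q prime,
corank_q = r_an) → BirchSwinnertonDyer`. CONDITIONAL. [folklore] -/
theorem tangentCone_bsd_of_items_of_cmAnchor
    (hE : Summit.BirchSwinnertonDyer.BirchSwinnertonDyer.Theses.TangentCone.EdgeDecay)
    (hC : Summit.BirchSwinnertonDyer.BirchSwinnertonDyer.Theses.TangentCone.EdgeCap)
    (hLB : Summit.BirchSwinnertonDyer.BirchSwinnertonDyer.Theses.TangentCone.SelmerRankLB)
    (hSha : Summit.BirchSwinnertonDyer.BirchSwinnertonDyer.Theses.TangentCone.SelmerRankShaPFinite)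
    (hR1 : Summit.BirchSwinnertonDyer.BirchSwinnertonDyer.Theses.TangentCone.RankLeOne)
    (hAnchor : ∀ (W : WeierstrassCurve ℚ) [W.IsElliptic] [W.IsGloballyMinimal], W.HasCM →
      2 ≤ W.analyticRank → ∃ (q : ℕ) (_ : Fact q.Prime), W.selmerCorank q = W.analyticRank) :
    _root_.BirchSwinnertonDyer :=
  Summit.BirchSwinnertonDyer.BirchSwinnertonDyer.Theses.TangentCone.closes hE hC hLB hSha
    (tangentCone_selmerRankSmallImage_of_cmAnchor hE hC hLB hSha hR1 hAnchor) hR1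

end Summit.BirchSwinnertonDyer.BirchSwinnertonDyer.Theorems
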